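import Summits.AtomisticToContinuum.FouriersLaw.Theorems.OddSectorIrreversibilityCorrectorTheoryExistence
import Summits.AtomisticToContinuum.FouriersLaw.Theorems.OddSectorIrreversibilityOddDensityIsCorrectorDetailedBalance
import Summits.AtomisticToContinuum.FouriersLaw.Theorems.BondHeatUncertaintyLightConeBondHeatAutocorrelation
import HarnessLib

/-!
# `stub_anchoredKubo` of line `loomis-compact-horizon-witness`, part 1: pair correlations and Fubini
(crux `EmbeddedDrudeMourre.AbelThermodynamicLimit`, item stmt-AtomisticToContinuum-12596;
`--supports` helper file for the registered stub S3 `stub_anchoredKubo`, closes nothing)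

The registered stub S3: for `P = pinnedChain ω₂ lam β γ` (all `> 0`), under weak-NESS uniqueness,
for every steady family `μ`, response sequence `Dn` at `T > 0` and `N ≥ 2`, (1) every equilibrium
pair correlation `t ↦ ⟨j_i(0) j_k(t)⟩_{N,T} = ∫ j_i · P_t j_k dμ_T` (constructed kernels
`transitionKernel N T T t`, Gibbs measure `gibbsMeasure N T`) is integrable on `(0,∞)`, and
(2) `T² · Dn N = Σ_k ∫₀^∞ ⟨j_c(0) j_k(t)⟩_{N,T} dt` at the central bond `c = ⌊(N-1)/2⌋`.

This file (sorry-free, `N ≥ 1`, `T > 0`):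

* §1 cross correlations `K_{f,g}(t) = ∫ f · P_{t⁺} g dμ_T` of continuous observables of exponential
  class (`|·| ≤ C e^{ϑH}`, `2ϑ < 1/T`): measurable in `t`, `|K_{f,g}(t)| ≤ C' e^{-ct}` when
  `μ_T(g) = 0` (CEHR (2.5) at equilibrium, limit identified), hence integrable on `(0,∞)`;
  CONJUNCT (1) of the stub for all bond pairs (registered sub-goal `stub_anchoredKuboPairCorr`).
* §2 Fubini for the Kubo pairing: with `J = Σ_k j_k` and the Kubo corrector
  `u⋆ = ∫_{(0,∞)} P_t J dt` (absolutely convergent, envelope `|P_t J| ≤ MC e^{ϑH} e^{-ct}`):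
  `∫_{(0,∞)} (∫ f · P_t J dμ_T) dt = ∫ f u⋆ dμ_T` and
  `Σ_k ∫_{(0,∞)} (∫ f · P_t j_k dμ_T) dt = ∫ f u⋆ dμ_T` — the anchored Green–Kubo sum of the stub is
  the static pairing `∫ j_c u⋆ dμ_T`.

Conjunct (2) is reduced to the response-density items of route `OddSectorIrreversibility`
(stmt-9144, stmt-9146) in part 3 (`…AnchoredKubo.lean`); DC-flatness is part 2.
References: Cuneo–Eckmann–Hairer–Rey-Bellet 2018, Thm 2.13 (3); Kundu–Dhar–Narayan 2009.
-/

noncomputable section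

open MeasureTheory ProbabilityTheory Filter Topology Set Function
open scoped NNReal ENNReal

namespace Summit.AtomisticToContinuum.FouriersLaw.Theorems.AbelThermodynamicLimit.LoomisCompactHorizonWitness

open Literature.MathematicalPhysics.KineticTheory.HeatConduction
open Literature.MathematicalPhysics.KineticTheory OscillatorChain
open Summit.AtomisticToContinuum.FouriersLaw.Theorems.SubdiffusiveBondHeat
open Summit.AtomisticToContinuum.FouriersLaw.Theorems.LightConeBondHeat
open Summit.AtomisticToContinuum.FouriersLaw.Theorems.OddSectorIrreversibility
open Summit.AtomisticToContinuum.FouriersLaw.Theorems.OddSectorIrreversibility.Corrector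

variable {N : ℕ}

/-! ## §1 Cross correlations of observables of exponential class -/

section CrossCorr

variable {ω₂ lam β γ : ℝ} (hω : 0 < ω₂) (hl : 0 ≤ lam) (hβ : 0 < β) (hγ : 0 < γ) (hN : 0 < N)
  {T : ℝ} (hT : 0 < T) {ϑ Cf Cg : ℝ} (hϑ0 : 0 < ϑ) (h2ϑ : 2 * ϑ < 1 / T) {f g : PhaseSpace N → ℝ}
  (hf : Continuous f) (hfb : ∀ y, |f y| ≤ Cf * Real.exp (ϑ * (pinnedChain ω₂ lam β γ).hamiltonian N y))
  (hg : Continuous g) (hgb : ∀ y, |g y| ≤ Cg * Real.exp (ϑ * (pinnedChain ω₂ lam β γ).hamiltonian N y))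
include hω hl hβ hγ hN hT hϑ0 h2ϑ hf hfb hg hgb

omit hβ hγ hN hϑ0 h2ϑ hfb hgb in
/-- `t ↦ K_{f,g}(t) = ∫ f · P_{t⁺} g dμ_T` is measurable (joint measurability of the kernels in
`(t, z)`). [folklore] -/
theorem pinnedChain_measurable_crossCorr (hβ : 0 ≤ β) (hγ : 0 ≤ γ) :
    Measurable fun u : ℝ => ∫ z, f z *
        (∫ y, g y ∂((pinnedChain ω₂ lam β γ).transitionKernel N T T u.toNNReal z))
      ∂((pinnedChain ω₂ lam β γ).gibbsMeasure N T) := by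
  set P := pinnedChain ω₂ lam β γ with hP
  set μ := P.gibbsMeasure N T with hμ
  haveI : IsProbabilityMeasure μ := pinnedChain_isProbabilityMeasure_gibbsMeasure hω hl hβ γ N hT
  have h2 : StronglyMeasurable fun q : ℝ × PhaseSpace N =>
      ∫ y, g y ∂(P.transitionKernel N T T q.1.toNNReal q.2) :=
    pinnedChain_stronglyMeasurable_act_uncurry hω hl hβ hγ T T hg.measurable
  have h1 : StronglyMeasurable fun q : ℝ × PhaseSpace N => f q.2 :=
    (hf.comp continuous_snd).stronglyMeasurable
  exact ((h1.mul h2).integral_prod_right' (ν := μ)).measurable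

omit hγ hN hϑ0 hg hgb in
/-- The weight `|f| e^{ϑH}` (`≤ C e^{2ϑH}`) is `μ_T`-integrable for `2ϑ < 1/T`. [folklore] -/
theorem pinnedChain_integrable_abs_mul_exp :
    Integrable (fun z => |f z| * Real.exp (ϑ * (pinnedChain ω₂ lam β γ).hamiltonian N z))
      ((pinnedChain ω₂ lam β γ).gibbsMeasure N T) := by
  set P := pinnedChain ω₂ lam β γ with hP
  have h2 := pinnedChain_integrable_exp_mul_hamiltonian_gibbsMeasure hω hl hβ.le γ N hT h2ϑ
  refine (h2.const_mul Cf).mono' ((continuous_abs.comp hf).mul (Real.continuous_exp.comp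
    (continuous_const.mul (pinnedChain_continuous_hamiltonian ω₂ lam β γ N)))).aestronglyMeasurable
    (Eventually.of_forall fun z => ?_)
  rw [Real.norm_eq_abs, abs_mul, abs_abs, abs_of_pos (Real.exp_pos _)]
  calc |f z| * Real.exp (ϑ * P.hamiltonian N z) ≤ (Cf * Real.exp (ϑ * P.hamiltonian N z)) *
      Real.exp (ϑ * P.hamiltonian N z) := mul_le_mul_of_nonneg_right (hfb z) (Real.exp_pos _).le
    _ = Cf * Real.exp (2 * ϑ * P.hamiltonian N z) := by rw [mul_assoc, ← Real.exp_add]; ring_nf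

/-- **Exponential decay of the cross correlation**: if `μ_T(g) = 0` then
`|K_{f,g}(t)| ≤ C' e^{-ct}` for `t ≥ 0` (`c > 0`; CEHR (2.5) at equilibrium with the limit
identified, integrated against `|f| e^{ϑH} ∈ L¹(μ_T)`). The rate depends on `N`.
[cite: CuneoEckmannHairerReyBellet2018, Thm 2.13 (3)] -/
theorem pinnedChain_crossCorr_exp_decay
    (h0 : ∫ z, g z ∂((pinnedChain ω₂ lam β γ).gibbsMeasure N T) = 0) :
    ∃ C' c : ℝ, 0 < c ∧ ∀ u : ℝ, 0 ≤ u →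
      |∫ z, f z * (∫ y, g y ∂((pinnedChain ω₂ lam β γ).transitionKernel N T T u.toNNReal z))
        ∂((pinnedChain ω₂ lam β γ).gibbsMeasure N T)| ≤ C' * Real.exp (-c * u) := by
  set P := pinnedChain ω₂ lam β γ with hP
  set μ := P.gibbsMeasure N T with hμ
  have hϑ1 : ϑ < 1 / T := by linarith
  obtain ⟨C₀, c, hC₀, hc, hconv⟩ := pinnedChain_exp_convergence_gibbs hω hl hβ hγ hN hT hϑ0 hϑ1
  set M : ℝ := |Cg| + 1 with hM
  have hM0 : 0 < M := by positivity
  have hgM : ∀ y, |g y| ≤ M * Real.exp (ϑ * P.hamiltonian N y) := fun y =>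
    (hgb y).trans (mul_le_mul_of_nonneg_right (by rw [hM]; linarith [le_abs_self Cg]) (Real.exp_pos _).le)
  have hwint := pinnedChain_integrable_abs_mul_exp hω hl hβ hT h2ϑ hf hfb
  set W : ℝ := ∫ z, |f z| * Real.exp (ϑ * P.hamiltonian N z) ∂μ with hW
  refine ⟨M * C₀ * W, c, hc, fun u hu => ?_⟩
  have hpt : ∀ z, |∫ y, g y ∂(P.transitionKernel N T T u.toNNReal z)| ≤
      M * C₀ * Real.exp (ϑ * P.hamiltonian N z) * Real.exp (-c * u) := by
    intro z
    have hg' : Continuous fun y => M⁻¹ * g y := continuous_const.mul hg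
    have hgb' : ∀ y, |M⁻¹ * g y| ≤ Real.exp (ϑ * P.hamiltonian N y) := fun y => by
      rw [abs_mul, abs_of_pos (inv_pos.2 hM0), inv_mul_le_iff₀ hM0]
      exact hgM y
    have h := hconv z u.toNNReal _ hg' hgb'
    rw [integral_const_mul, integral_const_mul, h0, mul_zero, sub_zero, abs_mul,
      abs_of_pos (inv_pos.2 hM0), inv_mul_le_iff₀ hM0, Real.coe_toNNReal _ hu] at h
    calc |∫ y, g y ∂(P.transitionKernel N T T u.toNNReal z)|
        ≤ M * (C₀ * Real.exp (ϑ * P.hamiltonian N z) * Real.exp (-c * u)) := h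
      _ = M * C₀ * Real.exp (ϑ * P.hamiltonian N z) * Real.exp (-c * u) := by ring
  have hbound : ∀ z, ‖f z * ∫ y, g y ∂(P.transitionKernel N T T u.toNNReal z)‖ ≤
      M * C₀ * Real.exp (-c * u) * (|f z| * Real.exp (ϑ * P.hamiltonian N z)) := fun z => by
    rw [Real.norm_eq_abs, abs_mul]
    calc |f z| * |∫ y, g y ∂(P.transitionKernel N T T u.toNNReal z)|
        ≤ |f z| * (M * C₀ * Real.exp (ϑ * P.hamiltonian N z) * Real.exp (-c * u)) :=
          mul_le_mul_of_nonneg_left (hpt z) (abs_nonneg _)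
      _ = M * C₀ * Real.exp (-c * u) * (|f z| * Real.exp (ϑ * P.hamiltonian N z)) := by ring
  have := norm_integral_le_of_norm_le (hwint.const_mul (M * C₀ * Real.exp (-c * u)))
    (Eventually.of_forall hbound)
  rw [integral_const_mul, Real.norm_eq_abs] at this
  calc _ ≤ M * C₀ * Real.exp (-c * u) * W := this
    _ = M * C₀ * W * Real.exp (-c * u) := by ring

/-- **Integrability of the cross correlation on `(0, ∞)`** when `μ_T(g) = 0`: measurable and
dominated by `C' e^{-ct}`. [folklore] -/
theorem pinnedChain_integrableOn_crossCorr
    (h0 : ∫ z, g z ∂((pinnedChain ω₂ lam β γ).gibbsMeasure N T) = 0) :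
    IntegrableOn (fun u : ℝ => ∫ z, f z *
        (∫ y, g y ∂((pinnedChain ω₂ lam β γ).transitionKernel N T T u.toNNReal z))
      ∂((pinnedChain ω₂ lam β γ).gibbsMeasure N T)) (Ioi 0) := by
  obtain ⟨C', c, hc, hdec⟩ :=
    pinnedChain_crossCorr_exp_decay hω hl hβ hγ hN hT hϑ0 h2ϑ hf hfb hg hgb h0
  have hmeas := pinnedChain_measurable_crossCorr hω hl hT hf hg hβ.le hγ.le
  refine Integrable.mono' ((exp_neg_integrableOn_Ioi 0 hc).const_mul C')
    hmeas.aestronglyMeasurable ?_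
  refine (ae_restrict_iff' measurableSet_Ioi).2 (Eventually.of_forall fun u hu => ?_)
  rw [Real.norm_eq_abs]
  exact hdec u (le_of_lt hu)

/-- `z ↦ f(z) · P_u g(z)` is `μ_T`-integrable for nice `f, g` (`f², (P_u g)² ∈ L¹(μ_T)` by the
`L²`-contraction of the kernels). [folklore] -/
theorem pinnedChain_integrable_mul_act (u : ℝ≥0) :
    Integrable (fun z => f z * ∫ y, g y ∂((pinnedChain ω₂ lam β γ).transitionKernel N T T u z))
      ((pinnedChain ω₂ lam β γ).gibbsMeasure N T) := by
  obtain ⟨hf2, -, -⟩ := pinnedChain_integral_sq_act_le hω hl hβ hγ hN hT hϑ0 h2ϑ hf hfb u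
  obtain ⟨-, hg2, -⟩ := pinnedChain_integral_sq_act_le hω hl hβ hγ hN hT hϑ0 h2ϑ hg hgb u
  refine integrable_mul_of_integrable_sq hf.aestronglyMeasurable ?_ hf2 hg2
  exact (hg.stronglyMeasurable.integral_kernel
    (κ := (pinnedChain ω₂ lam β γ).transitionKernel N T T u)).aestronglyMeasurable

end CrossCorr


/-! ## §2 The anchored Green–Kubo sum is the static pairing with the Kubo corrector -/

section Kubo

variable {ω₂ lam β γ : ℝ} (hω : 0 < ω₂) (hl : 0 < lam) (hβ : 0 < β) (hγ : 0 < γ) (hN : 0 < N)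
  {T : ℝ} (hT : 0 < T)
include hω hl hβ hγ hN hT

/-- **Linearity in the kernel slot**: for nice `f` (`|f| ≤ C e^{H/(4T)}`) and every `t`,
`∫ f · P_t J dμ_T = Σ_k ∫ f · P_t j_k dμ_T` (`J = Σ_k j_k`; every `j_k` is `P_t(z,·)`-integrable and
every `f · P_t j_k` is `μ_T`-integrable). [folklore] -/
theorem integral_mul_act_total_eq_sum {f : PhaseSpace N → ℝ} (hf : Continuous f)
    {Cf : ℝ} (hfb : ∀ y, |f y| ≤ Cf * Real.exp (1 / (4 * T) * (pinnedChain ω₂ lam β γ).hamiltonian N y))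
    (t : ℝ) :
    ∫ z, f z * (∫ y, (∑ i : Fin N, (pinnedChain ω₂ lam β γ).bondCurrent N i y)
        ∂((pinnedChain ω₂ lam β γ).transitionKernel N T T t.toNNReal z))
      ∂((pinnedChain ω₂ lam β γ).gibbsMeasure N T) =
    ∑ k : Fin N, ∫ z, f z * (∫ y, (pinnedChain ω₂ lam β γ).bondCurrent N k y
        ∂((pinnedChain ω₂ lam β γ).transitionKernel N T T t.toNNReal z))
      ∂((pinnedChain ω₂ lam β γ).gibbsMeasure N T) := by
  set P := pinnedChain ω₂ lam β γ with hP
  obtain ⟨hϑ0, h2ϑ⟩ := quarter_inv_temp_admissible hT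
  have hϑ1 : 1 / (4 * T) < 1 / T := by linarith
  have hjc : ∀ k : Fin N, Continuous (P.bondCurrent N k) := pinnedChain_continuous_bondCurrent ω₂ lam β γ N
  have hjb := fun k : Fin N => pinnedChain_abs_bondCurrent_le_exp hω.le hl.le hβ.le γ N hϑ0 k
  have hk : ∀ z, ∫ y, (∑ i : Fin N, P.bondCurrent N i y) ∂(P.transitionKernel N T T t.toNNReal z) =
      ∑ k : Fin N, ∫ y, P.bondCurrent N k y ∂(P.transitionKernel N T T t.toNNReal z) := by
    intro z
    exact integral_finsetSum _ fun k _ => integrable_of_abs_le_exp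
      (pinnedChain_integrable_exp_mul_hamiltonian_transitionKernel hω hl.le hT hβ.le hγ.le hN hϑ0
        hϑ1 _ z) (hjc k) (hjb k)
  simp_rw [hk, Finset.mul_sum]
  exact integral_finsetSum _ fun k _ =>
    pinnedChain_integrable_mul_act hω hl.le hβ hγ hN hT hϑ0 h2ϑ hf hfb (hjc k) (hjb k) _

/-- **Fubini for the Kubo pairing (total current).** For nice `f`, the total current `J = Σ_k j_k`
and the Kubo corrector `u⋆(z) = ∫_{(0,∞)} P_t J(z) dt`:
`∫_{(0,∞)} (∫ f · P_t J dμ_T) dt = ∫ f u⋆ dμ_T`, and `t ↦ ∫ f · P_t J dμ_T` is integrable on `(0,∞)`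
(absolute convergence from the envelope `|P_t J| ≤ M C e^{ϑH} e^{-ct}`, CEHR (2.5) with
`μ_T(J) = 0`). [folklore] -/
theorem integral_crossCorr_total_eq_integral_mul_kubo {f : PhaseSpace N → ℝ} (hf : Continuous f)
    {Cf : ℝ} (hfb : ∀ y, |f y| ≤ Cf * Real.exp (1 / (4 * T) * (pinnedChain ω₂ lam β γ).hamiltonian N y)) :
    IntegrableOn (fun t : ℝ => ∫ z, f z * (∫ y, (∑ i : Fin N, (pinnedChain ω₂ lam β γ).bondCurrent N i y)
        ∂((pinnedChain ω₂ lam β γ).transitionKernel N T T t.toNNReal z))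
      ∂((pinnedChain ω₂ lam β γ).gibbsMeasure N T)) (Ioi 0) ∧
    ∫ t in Ioi (0 : ℝ), ∫ z, f z * (∫ y, (∑ i : Fin N, (pinnedChain ω₂ lam β γ).bondCurrent N i y)
          ∂((pinnedChain ω₂ lam β γ).transitionKernel N T T t.toNNReal z))
        ∂((pinnedChain ω₂ lam β γ).gibbsMeasure N T) =
      ∫ z, f z * (∫ t in Ioi (0 : ℝ), ∫ y, (∑ i : Fin N, (pinnedChain ω₂ lam β γ).bondCurrent N i y)
          ∂((pinnedChain ω₂ lam β γ).transitionKernel N T T t.toNNReal z))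
        ∂((pinnedChain ω₂ lam β γ).gibbsMeasure N T) := by
  set P := pinnedChain ω₂ lam β γ with hP
  set μ := P.gibbsMeasure N T with hμ
  set κ : ℝ → Kernel (PhaseSpace N) (PhaseSpace N) := fun t => P.transitionKernel N T T t.toNNReal
    with hκ
  set J : PhaseSpace N → ℝ := fun y => ∑ i : Fin N, P.bondCurrent N i y with hJ
  haveI : IsProbabilityMeasure μ := pinnedChain_isProbabilityMeasure_gibbsMeasure hω hl.le hβ.le γ N hT
  obtain ⟨hϑ0, h2ϑ⟩ := quarter_inv_temp_admissible hT
  set ϑ : ℝ := 1 / (4 * T) with hϑ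
  have hϑ1 : ϑ < 1 / T := by linarith
  have hJc : Continuous J := continuous_totalBondCurrent ω₂ lam β γ N
  obtain ⟨M, C, c, hM, hC, hc, hJM, hdecay⟩ := totalBondCurrent_decay hω hl hβ hγ hT hN hϑ0 hϑ1
  -- the joint integrand is integrable on `(0,∞) × μ_T`
  have hwint := pinnedChain_integrable_abs_mul_exp hω hl.le hβ hT h2ϑ hf hfb
  have hGm : AEStronglyMeasurable (fun q : ℝ × PhaseSpace N => f q.2 * ∫ y, J y ∂(κ q.1 q.2))
      ((volume.restrict (Ioi (0 : ℝ))).prod μ) :=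
    ((hf.comp continuous_snd).stronglyMeasurable.mul
      (pinnedChain_stronglyMeasurable_act_uncurry hω hl.le hβ.le hγ.le T T hJc.measurable)).aestronglyMeasurable
  have hGint : Integrable (fun q : ℝ × PhaseSpace N => f q.2 * ∫ y, J y ∂(κ q.1 q.2))
      ((volume.restrict (Ioi (0 : ℝ))).prod μ) := by
    refine Integrable.mono' (((exp_neg_integrableOn_Ioi 0 hc).mul_prod (hwint.const_mul (M * C))))
      hGm (Eventually.of_forall fun q => ?_)
    rw [Real.norm_eq_abs, abs_mul]
    have h1 := hdecay q.2 q.1.toNNReal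
    have h2 : Real.exp (-c * (q.1.toNNReal : ℝ)) ≤ Real.exp (-c * q.1) := by
      refine Real.exp_le_exp.2 ?_
      have : q.1 ≤ (q.1.toNNReal : ℝ) := Real.le_coe_toNNReal q.1
      nlinarith
    have h3 : |∫ y, J y ∂(κ q.1 q.2)| ≤ M * C * Real.exp (ϑ * P.hamiltonian N q.2) * Real.exp (-c * q.1) :=
      h1.trans (mul_le_mul_of_nonneg_left h2 (by positivity))
    calc |f q.2| * |∫ y, J y ∂(κ q.1 q.2)|
        ≤ |f q.2| * (M * C * Real.exp (ϑ * P.hamiltonian N q.2) * Real.exp (-c * q.1)) :=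
          mul_le_mul_of_nonneg_left h3 (abs_nonneg _)
      _ = Real.exp (-c * q.1) * (M * C * (|f q.2| * Real.exp (ϑ * P.hamiltonian N q.2))) := by ring
  have hGint' : Integrable (uncurry fun z t => f z * ∫ y, J y ∂(κ t z))
      (μ.prod (volume.restrict (Ioi (0 : ℝ)))) := hGint.swap
  refine ⟨hGint.integral_prod_left, ?_⟩
  -- Fubini
  calc ∫ t in Ioi (0 : ℝ), ∫ z, f z * (∫ y, J y ∂(κ t z)) ∂μ
      = ∫ z, (∫ t in Ioi (0 : ℝ), f z * (∫ y, J y ∂(κ t z))) ∂μ := (integral_integral_swap hGint').symm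
    _ = ∫ z, f z * (∫ t in Ioi (0 : ℝ), ∫ y, J y ∂(κ t z)) ∂μ := by
        refine integral_congr_ae (Eventually.of_forall fun z => ?_)
        exact integral_const_mul (f z) _

/-- **Fubini for the anchored Kubo pairing.** For nice `f` (`|f| ≤ C e^{H/(4T)}`), the total current
`J = Σ_k j_k` and the Kubo corrector `u⋆(z) = ∫_{(0,∞)} P_t J(z) dt`:
`Σ_k ∫_{(0,∞)} (∫ f · P_t j_k dμ_T) dt = ∫ f u⋆ dμ_T`. [folklore] -/
theorem sum_integral_crossCorr_eq_integral_mul_kubo {f : PhaseSpace N → ℝ} (hf : Continuous f)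
    {Cf : ℝ} (hfb : ∀ y, |f y| ≤ Cf * Real.exp (1 / (4 * T) * (pinnedChain ω₂ lam β γ).hamiltonian N y)) :
    ∑ k : Fin N, ∫ t in Ioi (0 : ℝ), ∫ z, f z *
        (∫ y, (pinnedChain ω₂ lam β γ).bondCurrent N k y
          ∂((pinnedChain ω₂ lam β γ).transitionKernel N T T t.toNNReal z))
        ∂((pinnedChain ω₂ lam β γ).gibbsMeasure N T) =
      ∫ z, f z * (∫ t in Ioi (0 : ℝ), ∫ y, (∑ i : Fin N, (pinnedChain ω₂ lam β γ).bondCurrent N i y)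
          ∂((pinnedChain ω₂ lam β γ).transitionKernel N T T t.toNNReal z))
        ∂((pinnedChain ω₂ lam β γ).gibbsMeasure N T) := by
  set P := pinnedChain ω₂ lam β γ with hP
  set μ := P.gibbsMeasure N T with hμ
  obtain ⟨hϑ0, h2ϑ⟩ := quarter_inv_temp_admissible hT
  have hjc : ∀ k : Fin N, Continuous (P.bondCurrent N k) := pinnedChain_continuous_bondCurrent ω₂ lam β γ N
  have hjb := fun k : Fin N => pinnedChain_abs_bondCurrent_le_exp hω.le hl.le hβ.le γ N hϑ0 k
  have hIk : ∀ k : Fin N, IntegrableOn (fun t : ℝ => ∫ z, f z *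
      (∫ y, P.bondCurrent N k y ∂(P.transitionKernel N T T t.toNNReal z)) ∂μ) (Ioi 0) := fun k =>
    pinnedChain_integrableOn_crossCorr hω hl.le hβ hγ hN hT hϑ0 h2ϑ hf hfb (hjc k) (hjb k)
      (pinnedChain_integral_bondCurrent_gibbsMeasure ω₂ lam β γ N T k)
  rw [← integral_finsetSum _ fun k _ => hIk k,
    ← (integral_crossCorr_total_eq_integral_mul_kubo hω hl hβ hγ hN hT hf hfb).2]
  refine integral_congr_ae (Eventually.of_forall fun t => ?_)
  exact (integral_mul_act_total_eq_sum hω hl hβ hγ hN hT hf hfb t).symm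

end Kubo

/-! ## Conjunct (1) of the stub: every pair correlation of bond currents is integrable on `(0, ∞)` -/

/-- **Registered sub-goal `stub_anchoredKuboPairCorr` = CONJUNCT (1) of `stub_anchoredKubo`** (with
the spectator hypotheses of the stub dropped): for `P = pinnedChain ω₂ lam β γ` (all `> 0`), `T > 0`,
`N ≥ 1` and all bonds `i, k`, the equilibrium pair correlation `t ↦ ∫ j_i · P_{t⁺} j_k dμ_T` is
integrable on `(0, ∞)` (no current at equilibrium, `μ_T(j_k) = 0`, and exponential convergence (2.5)
at fixed `N`). [folklore] -/
theorem stub_anchoredKuboPairCorr :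
    ∀ ω₂ lam β γ : ℝ, 0 < ω₂ → 0 < lam → 0 < β → 0 < γ → ∀ T : ℝ, 0 < T →
      ∀ (N : ℕ), 0 < N → ∀ i k : Fin N,
        MeasureTheory.IntegrableOn (fun t : ℝ =>
          ∫ z, (Literature.MathematicalPhysics.KineticTheory.HeatConduction.pinnedChain ω₂ lam β γ).bondCurrent N i z *
            (∫ y, (Literature.MathematicalPhysics.KineticTheory.HeatConduction.pinnedChain ω₂ lam β γ).bondCurrent N k y
              ∂((Literature.MathematicalPhysics.KineticTheory.HeatConduction.pinnedChain ω₂ lam β γ).transitionKernel N T T t.toNNReal z))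
          ∂((Literature.MathematicalPhysics.KineticTheory.HeatConduction.pinnedChain ω₂ lam β γ).gibbsMeasure N T)) (Set.Ioi 0) := by
  intro ω₂ lam β γ hω hl hβ hγ T hT N hN i k
  exact pinnedChain_integrableOn_crossCorr hω hl.le hβ hγ hN hT (quarter_inv_temp_admissible hT).1
    (quarter_inv_temp_admissible hT).2 (pinnedChain_continuous_bondCurrent ω₂ lam β γ N i)
    (pinnedChain_abs_bondCurrent_le_exp hω.le hl.le hβ.le γ N (quarter_inv_temp_admissible hT).1 i)
    (pinnedChain_continuous_bondCurrent ω₂ lam β γ N k)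
    (pinnedChain_abs_bondCurrent_le_exp hω.le hl.le hβ.le γ N (quarter_inv_temp_admissible hT).1 k)
    (pinnedChain_integral_bondCurrent_gibbsMeasure ω₂ lam β γ N T k)

end Summit.AtomisticToContinuum.FouriersLaw.Theorems.AbelThermodynamicLimit.LoomisCompactHorizonWitness

end
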